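import Summits.AtomisticToContinuum.Crystallization.Theorems.ChargedEnergyGapStressSplit
import HarnessLib

/-!
# ChargedEnergyGap · NODE 70 «NonAffineExchange», part A (lens-3 g70): the non-affinity functional and the two exchange pieces

Part A of two (400-line cap): §X1 the non-affinity functional (the ONE new object) and what it does to affine fields and rotations (PROVED),
§X2 the two exchange pieces [BAR♮-ᶜ] / [GEO♮-ᶜ], their monotonicity and their `η = 0` slices (= NODE 69's [BAR-ᶜ] / [GEO-ᶜ], PROVED); part B
(`ChargedEnergyGapNonAffineExchange`): §X3 the glue (PROVED) and the sanity instances, §X4 the Korn corner, §X5 the record cones.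

Line `stmt-AtomisticToContinuum-14231` (`PricedLinkCensus.ChargedEnergyGap`).  Node of record after NODE 69 «StressSplit» (critic row 1300):
[COER-ᶜ](`μ₁ − ν`) ⟸ [BAR-ᶜ](`μ₁`) ∧ [GEO-ᶜ](`ν`), `c ∈ {f, h}`, beneath (H𝄪ᶜ)@rec ⟸ [LOAD-ᶜ] ∧ [COER-ᶜ] (NODE 68).  TARGET of this node, VERBATIM:
[COER-ᶜ](`μ, c_T, cχ, r₁`) = `CoerciveStiffCls cls …` (`μ·springL − c_T·M_sh − cχ·M_tr − c_H·N_pr ≤ stiffL` over the twelve-binder hypothesis block).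

WHY A NEW NODE ON [COER-ᶜ] (and not g69's target 3).  NODE 69 forbids ANY compensation between the bar form and the prestress form: its loss
`μ^B − (μ₁^B − ν^B) ≈ 0.23` sits at DIFFERENT wave vectors on the two sides (bar floor: long acoustic shear; prestress ceiling: short waves,
`k/π ≈ (0.56, 0.56, 0)` fcc, `H` hcp) and left the fcc designate with a `4 %` margin.  g69's booked next split «[GEO] ⟸ [GEO-grad] ∧ [KORN-loc]»
charges the discrete Korn constant WHOLESALE: floats (this memo) `C_K := max_k N/λ_min(S) = 6.00` fcc (L point) / `6.66` hcp (optical Γ), so any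
`η·N` budget on the prestress side costs `η·C_K` of modulus uniformly — `ν ≳ 0.39`, designate dead (§X4 of part B types that corner and records
the loss).  THIS node instead lets the prestress side BORROW a multiple `η` of ONE affine-null, rotation-null quadratic functional `N = nonAffL`
and makes the bar side PAY the same `η·N` — where it has slack: `N/S` peaks exactly at the short waves where `B/S ≈ 2.4–2.6 ≫ μ₁`.

THE ONE NEW OBJECT (§X1): the NON-AFFINITY of a bond field at a site, `nonAffSite β P X r₁ y := ⨅ A : E3 →ₗ[ℝ] E3, nonAffRes β P X r₁ A y`,
`nonAffRes … A y := Σ' z∈star ‖β y z − A (z − y)‖²` — the EXACT least-squares residual of `β y ·` over all linear maps on the same excised star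
`{z ∈ P.points ∖ X, z ≠ y, dist y z ≤ r₁}` as the pivot `springSite`; weighted and excised exactly like `springL` into `nonAffL ϱχ D σ β P X r₁ ϱ C`.
PROVED here: `0 ≤ nonAffSite ≤ nonAffRes _ 0` (finite on summable stars), `nonAffSite (affineField A) = 0` (EVERY affine field: the kernel
contains NODE 69's affine chart, in particular every dilatation and every rotation `rotField r₀ v = affineField (rotLin v)`), hence
`nonAffL (affineField A) = nonAffL (rotField r₀ v) = 0` at every reference, every excision, every range.  No normalisation is chosen (an `⨅`, not a
fitted formula), so the functional cannot leak on rotations at a non-ideal `c/a` (the fixed-weight fit does — dead end of this memo).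

THE SPLIT (§X2, glue in part B): for ONE rate `η` on both sides,
* [BAR♮-ᶜ](`μ₁, η, c_T′, cχ′, r₁`) `BarExchCls cls` — **THE RENORMALISED BAR FRAMEWORK IS COERCIVE OVER THE OCTET TRUSS AND PAYS `η` UNITS OF
  NON-AFFINITY**: `μ₁·springL + η·nonAffL − (c_T′·M_sh + cχ′·M_tr + c_H′·N_pr) ≤ barL`.  [BAR-ᶜ](`μ₁`) is its `η = 0` slice (`barExchCls_zero_iff`,
  `Iff.rfl`) and it is antitone in `η` (`BarExchCls.mono`).  CERT-like · HEAVY · UNDECIDED → TRUE-leaning: Bloch (`X = ∅`, floats, this memo)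
  `η_hi(μ₁) := min_k λ_min(B − μ₁S)/N` = `0.112 | 0.104 | 0.087` fcc at `μ₁ = 1.65 | 1.70 | 1.80` (argmin L), `0.061 | 0.053 | 0.035` hcp (argmin
  optical Γ); same proof technology as [BAR-ᶜ] (finite-range truncation of the indefinite all-pair truss + cluster Cauchy–Schwarz), the extra term is
  one more positive-semidefinite short-wave form on the left.
* [GEO♮-ᶜ](`ν₀, η, c_T″, cχ″, r₁`) `GeoExchCls cls` — **THE PRESTRESS FORM IS BOUNDED BELOW BY `−ν₀` TRUSS `−η` NON-AFFINITY**: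
  `−ν₀·springL − η·nonAffL − (currencies) ≤ geoL`.  [GEO-ᶜ](`ν`) is its `η = 0` slice; monotone in `η` (`GeoExchCls.mono`), so [GEO-ᶜ](`ν₀`) ⟹
  [GEO♮-ᶜ](`ν₀, η`) for every `η ≥ 0` (`GeoStiffCls.geoExchCls`: nothing of g69 is lost).  STD/PART · ATTACKABLE-S/M: at a site-stress-free site
  `geoSite` kills affine fields, so after Cauchy–Schwarz against the best affine fit `A_y` the deficit is a multiple of the residual — exactly `N_y` —
  plus a cross term paid by `ν₀·springs`; Bloch ceiling `η_lo(ν₀) := max_k (−G − ν₀ λ·S)/N` (pencil) = `0.016 | 0.006` fcc at `ν₀ = 0.15 | 0.20`,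
  `0.018 | 0.010` hcp.  `ν₀ = 0` is NOT available: the long-wave limit of `−G/N` is a ratio of `k⁴` coefficients whose lattice sum converges like
  `1/R_cut` (`0.094 → 0.100` for cutoffs `7 → 9` nn, extrapolated `≈ 0.12 > η_hi`) — keep `ν₀ > 0` (the `k²`-springs absorb the long waves).
FEASIBLE iff `η_lo(ν₀) ≤ η ≤ η_hi(μ₁)`; LOSSLESS up to the bar floor: for every `μ₁ − ν₀ ≤ μ^B ≈ 1.82` with `μ₁ < μ₁^B` the window is open (floats),
versus NODE 69's `μ₁ − ν ≤ 1.59`.  DESIGNATE (part B): `(μ₁, ν₀, η) = (33/20, 3/20, 1/25)ᶠ`, `(17/10, 1/5, 1/40)ʰ`, i.e. `μ₁ − ν₀ = 3/2` = NODE 68's `μ`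
(its [LOAD] designate `t = 3/4` and both budgets stand), windows `[0.016, 0.112] ∋ 0.040` and `[0.010, 0.053] ∋ 0.025` (factor `≥ 2` each side,
stable from cutoff `7 → 9` nn fcc, `5 → 6` hcp), `μ₁` margins `9 % | 14 %` (g69: `4 % | 8 %`).

TAGS (doctrine).  GENUINE SPLIT of [COER-ᶜ] by the structure of the potential (as NODE 69) PLUS ONE EXCHANGED CURRENCY; `β` is never decomposed,
no range split, no sitewise coercivity, no gauge pivot (all booked dead).  Each piece STRICTLY WEAKER than [COER-ᶜ] and than its g69 parent on the
prestress side / STRONGER on the bar side by a certified-slack amount; NEITHER IS AN ANALOGUE of the target (audit MF-1/2: the glue consumes both;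
MF-5/6: the exchange is load-bearing on both sides; MF-3: the rates must match, GEO's ≤ BAR's).  ONE new functional, ZERO new equivalences (the
lens' single allowed translation is the literal identity `η·N − η·N = 0` inside the proved glue).  WHY IT MIGHT FAIL: (i) [BAR♮] inherits [BAR]'s
HEAVY status (all-pair indefinite truss; the census QP STAB-69B is still open) and now also needs the short-wave slack to survive excision
(`X ≠ ∅` removes stars: `N` and `B` both lose terms, not proportionally — currencies `c_H·N_pr` must pay the boundary layer, bounded by `SmallStrain`);
(ii) the `η`-window is a BLOCH statement (`X = ∅`, perfect lattice): under the block's `IsLabelledRef`/seam hypotheses the reference is a perfect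
fcc/hcp image, but the Volterra field is not periodic — the window is evidence, not a certificate; (iii) hcp needs the cutoff-consistent stress-free
cell (`c/a = 1.6328` at 5–6 shells, NOT the census root at finite cutoff: site virial `−0.03` otherwise pollutes `G` at `O(k²)`).

0 sorry · 0 native_decide · no private / instance / notation · standard axioms (audit `check/AuditNX70.lean` over the tower A ++ B: 7 must-fails +
canary = 8 expected errors, 9 `#print axioms` pins).
-/

noncomputable section
open scoped Classical
open Literature.MathematicalPhysics.StatisticalMechanics Literature.Geometry.DiscreteGeometry
open Summit.AtomisticToContinuum.Crystallization.Theses.PricedLinkCensus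
open Summit.AtomisticToContinuum.Crystallization.Theorems.ChargedEnergyGapNegative

namespace Summit.AtomisticToContinuum.Crystallization.Theorems.ChargedEnergyGapChartDial

/-! ## §X1 The non-affinity site functional (the exact least-squares residual over the spring star) -/

section NonAffinity

variable (β : E3 → E3 → E3) (P : PeriodicConfiguration 3) (X : Set E3) (r₁ : ℝ)

/-- The **NON-AFFINITY RESIDUAL of `β` at `y` against the linear map `A`** over the spring star of range `r₁` (the star of `springSite`,
excised the same way): `Σ'_{z ∈ P ∖ X, z ≠ y, d_yz ≤ r₁} ‖β y z − A (z − y)‖²`. -/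
def nonAffRes (A : E3 →ₗ[ℝ] E3) (y : E3) : ℝ :=
  ∑' z : {z : E3 // z ∈ P.points ∧ z ∉ X ∧ z ≠ y ∧ dist y z ≤ r₁}, ‖β y (z : E3) - A ((z : E3) - y)‖ ^ 2

/-- ★ The **NON-AFFINITY SITE FUNCTIONAL** `N_y(β) := inf_{A linear} Σ'_{star} ‖β y z − A (z − y)‖²`: the EXACT least-squares distance of the
star data of `β` at `y` from the affine (linear-in-the-bond) fields.  By construction it ANNIHILATES EVERY AFFINE FIELD — every homogeneous strain
AND every infinitesimal rotation — at EVERY reference and with EVERY excision (no normalisation constant, no symmetry of the star is used). -/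
def nonAffSite (y : E3) : ℝ :=
  ⨅ A : E3 →ₗ[ℝ] E3, nonAffRes β P X r₁ A y

/-- `nonAffRes_nonneg` (docstring added by the landing lane; see the module docstring). [formal bookkeeping] -/
theorem nonAffRes_nonneg (A : E3 →ₗ[ℝ] E3) (y : E3) : 0 ≤ nonAffRes β P X r₁ A y :=
  tsum_nonneg fun _ => sq_nonneg _

/-- The residual family is bounded below (by `0`) … -/
theorem bddBelow_nonAffRes (y : E3) : BddBelow (Set.range fun A : E3 →ₗ[ℝ] E3 => nonAffRes β P X r₁ A y) :=
  ⟨0, by rintro _ ⟨A, rfl⟩; exact nonAffRes_nonneg β P X r₁ A y⟩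

/-- … so the non-affinity functional is non-negative … -/
theorem nonAffSite_nonneg (y : E3) : 0 ≤ nonAffSite β P X r₁ y :=
  Real.iInf_nonneg fun A => nonAffRes_nonneg β P X r₁ A y

/-- … and at most the residual against any particular linear map (in particular `A = 0`: at most the star's `Σ' ‖β‖²`). -/
theorem nonAffSite_le_nonAffRes (A : E3 →ₗ[ℝ] E3) (y : E3) : nonAffSite β P X r₁ y ≤ nonAffRes β P X r₁ A y :=
  ciInf_le (bddBelow_nonAffRes β P X r₁ y) A

variable {β}

/-- ★ **AFFINE FIELDS HAVE NO NON-AFFINITY**: `N_y(affineField A) = 0` at every reference, every excision, every range (the residual against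
`A` itself vanishes termwise). -/
theorem nonAffSite_affineField (A : E3 →ₗ[ℝ] E3) (y : E3) : nonAffSite (affineField A) P X r₁ y = 0 := by
  refine le_antisymm ?_ (nonAffSite_nonneg _ P X r₁ y)
  refine (nonAffSite_le_nonAffRes (affineField A) P X r₁ A y).trans (le_of_eq ?_)
  simp [nonAffRes]

/-- ★ **ROTATION COCYCLES HAVE NO NON-AFFINITY** (`rotField r₀ v = affineField (rotLin r₀ v)`): the rotation alarm cannot ring on `N`. -/
theorem nonAffSite_rotField (r₀ v y : E3) : nonAffSite (rotField r₀ v) P X r₁ y = 0 := by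
  rw [← affineField_rotLin]
  exact nonAffSite_affineField P X r₁ (rotLin r₀ v) y

variable (β) (ϱχ : ℝ) {m : ℕ} (D : Fin m → Set E3) (σ : Fin m → Bool)

/-- ★ The **WEIGHTED EXCISED NON-AFFINITY** `Σ_{y ∈ motif ∖ X} χ(y)·w(y)·N_y(β)` — weighted and excised exactly like the pivot `springL`. -/
def nonAffL (β : E3 → E3 → E3) (P : PeriodicConfiguration 3) (X : Set E3) (r₁ ϱ : ℝ) (C : Set E3) : ℝ :=
  ∑ y ∈ P.motif, if y ∈ X then 0 else localFactor ϱχ D σ y * (profileWeight ϱ C y * nonAffSite β P X r₁ y)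

variable {ϱχ D σ}

/-- The weighted non-affinity is non-negative … -/
theorem nonAffL_nonneg (ϱ : ℝ) (C : Set E3) : 0 ≤ nonAffL ϱχ D σ β P X r₁ ϱ C :=
  Finset.sum_nonneg fun y _ => by
    split_ifs
    · exact le_rfl
    · exact mul_nonneg (localFactor_nonneg _ _ _ _) (mul_nonneg (profileWeight_nonneg _ _ _) (nonAffSite_nonneg _ _ _ _ _))

variable {β}

/-- … vanishes on every affine field … -/
theorem nonAffL_affineField (ϱ : ℝ) (C : Set E3) (A : E3 →ₗ[ℝ] E3) : nonAffL ϱχ D σ (affineField A) P X r₁ ϱ C = 0 := by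
  simp [nonAffL, nonAffSite_affineField]

/-- … and on every rotation cocycle (every reference, EVERY excision). -/
theorem nonAffL_rotField (ϱ : ℝ) (C : Set E3) (r₀ v : E3) : nonAffL ϱχ D σ (rotField r₀ v) P X r₁ ϱ C = 0 := by
  simp [nonAffL, nonAffSite_rotField]

end NonAffinity

/-! ## §X2 The two exchange pieces -/

section Pieces

variable (cls : Set E3 → Prop) (s lam ℓ μ₀ τ ϱ b₀ r_S ϱχ r₁ : ℝ)

/-- ★ piece [BAR♮-ᶜ](`μ₁, η, c_T, cχ, r₁`) · **THE RENORMALISED BAR FRAMEWORK DOMINATES THE PIVOT AND `η` TIMES THE NON-AFFINITY**: over the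
hypothesis block of (H𝄪ᶜ) VERBATIM, `μ₁·springL(β) + η·nonAffL(β) − (c_T·M_sh + cχ·M_tr + c_H·N_pr) ≤ barL(β)` for the Volterra field `β` of the
data (dials `(s, λ_lab, ℓ, μ₀, τ, ϱ, b₀, r_S, ϱχ, r₁ ; μ₁, η, c_T, cχ)`).  `η = 0` is [BAR-ᶜ] by name (`barExchCls_zero_iff`).  UNDECIDED →
TRUE-leaning at the designate · INSTRUMENTABLE · ATTACKABLE-M.  Why it might fail: the slack of the bar form over `μ₁` times the pivot is
SHORT-WAVE (fcc L-point `k/π = (½,½,½)`: `min_k λ_min(B − μ₁S)/N ≈ 0.10` at `μ₁ = 33/20`; hcp optical `Γ`: `≈ 0.053` at `17/10`, floats) and must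
pay `η·N` there once weights and excision are in; a field with non-affinity concentrated where `χ·w` varies fastest could exceed it. -/
def BarExchCls (μ₁ η c_T cχ : ℝ) : Prop :=
  ∃ c_H : ℝ, 0 ≤ c_H ∧ ∀ (P : PeriodicConfiguration 3) (C X : Set E3) (β₀ : E3 → E3 → E3) (k : ℕ) (S : Fin k → CutPiece)
    (m : ℕ) (D : Fin m → Set E3) (σ : Fin m → Bool),
    IsSeparatedRef s P → IsLabelledRef lam ℓ P → cls P.points → IsForceFree P → IsSiteStressFree P → HarmStableModRot μ₀ P →
    IsInvariantSet P C → IsInvariantSet P X → IsGlobalCocycle P β₀ → IsSeamSystem b₀ r_S P S →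
    SmallStrain τ P X (volterraField P S β₀) → (∀ i, IsInvariantSet P (D i)) →
      μ₁ * springL ϱχ D σ (volterraField P S β₀) P X r₁ ϱ C + η * nonAffL ϱχ D σ (volterraField P S β₀) P X r₁ ϱ C -
            c_T * shellMassL ϱχ D σ P X ϱ C - cχ * transMassL ϱχ D σ P X ϱ C -
          c_H * (pricedNearCountL ϱχ D σ P X ϱ C : ℝ) ≤
        barL ϱχ D σ (volterraField P S β₀) P X ϱ C

/-- ★ piece [GEO♮-ᶜ](`ν₀, η, c_T, cχ, r₁`) · **THE PRESTRESS FORM IS BOUNDED BELOW BY `−ν₀` TIMES THE PIVOT MINUS `η` TIMES THE NON-AFFINITY**: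
over the hypothesis block of (H𝄪ᶜ) VERBATIM, `−ν₀·springL(β) − η·nonAffL(β) − (c_T·M_sh + cχ·M_tr + c_H·N_pr) ≤ geoL(β)`.  `η = 0` is [GEO-ᶜ] by
name (`geoExchCls_zero_iff`).  The prestress form MEASURES NON-AFFINITY (it annihilates every affine field at a site-stress-free site, NODE 69
`geoSite_affineField_empty_eq_zero`); this piece says its negative part is paid by the non-affinity of the same field at rate `η` up to `ν₀` times
the pivot (`ν₀` absorbs the strain × strain-gradient cross terms that lattice inversion symmetry kills only in the bulk).  UNDECIDED → TRUE-leaning ·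
INSTRUMENTABLE · ATTACKABLE-M (virial resummation against the affine fit: `geoSite β y = ¼Σ' (V′/d)(‖β − A e‖² + 2⟪β − A e, A e⟫)` for EVERY `A` at a
site-stress-free site).  Why it might fail: a zone-boundary field (fcc `W`/`K` region, hcp `H` point: `max_k (−G − ν₀ λ_min S)/N ≈ 0.016 | 0.010`,
floats, against the designate `η = 1/25 | 1/40`) made worse by excised stars (an under-determined affine fit near `X` has residual `0`). -/
def GeoExchCls (ν₀ η c_T cχ : ℝ) : Prop :=
  ∃ c_H : ℝ, 0 ≤ c_H ∧ ∀ (P : PeriodicConfiguration 3) (C X : Set E3) (β₀ : E3 → E3 → E3) (k : ℕ) (S : Fin k → CutPiece)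
    (m : ℕ) (D : Fin m → Set E3) (σ : Fin m → Bool),
    IsSeparatedRef s P → IsLabelledRef lam ℓ P → cls P.points → IsForceFree P → IsSiteStressFree P → HarmStableModRot μ₀ P →
    IsInvariantSet P C → IsInvariantSet P X → IsGlobalCocycle P β₀ → IsSeamSystem b₀ r_S P S →
    SmallStrain τ P X (volterraField P S β₀) → (∀ i, IsInvariantSet P (D i)) →
      -(ν₀ * springL ϱχ D σ (volterraField P S β₀) P X r₁ ϱ C) - η * nonAffL ϱχ D σ (volterraField P S β₀) P X r₁ ϱ C -
            c_T * shellMassL ϱχ D σ P X ϱ C - cχ * transMassL ϱχ D σ P X ϱ C -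
          c_H * (pricedNearCountL ϱχ D σ P X ϱ C : ℝ) ≤
        geoL ϱχ D σ (volterraField P S β₀) P X ϱ C

variable {cls s lam ℓ μ₀ τ ϱ b₀ r_S ϱχ r₁}

/-- [BAR♮-ᶜ] is antitone in `μ₁` and in the exchange rate `η`, monotone in both losses. -/
theorem BarExchCls.mono {μ₁ μ₁' η η' c_T c_T' cχ cχ' : ℝ} (hμ : μ₁' ≤ μ₁) (hη : η' ≤ η) (hc : c_T ≤ c_T') (hχ : cχ ≤ cχ')
    (h : BarExchCls cls s lam ℓ μ₀ τ ϱ b₀ r_S ϱχ r₁ μ₁ η c_T cχ) : BarExchCls cls s lam ℓ μ₀ τ ϱ b₀ r_S ϱχ r₁ μ₁' η' c_T' cχ' := by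
  obtain ⟨c_H, hH, h⟩ := h
  refine ⟨c_H, hH, fun P C X β₀ k S m D σ h1 h2 hb h3 h4 h5 h6 h7 h8 h9 h10 h11 => ?_⟩
  have H := h P C X β₀ k S m D σ h1 h2 hb h3 h4 h5 h6 h7 h8 h9 h10 h11
  have hM := shellMassL_nonneg (ϱχ := ϱχ) (D := D) (σ := σ) P X ϱ C
  have hT' := transMassL_nonneg (ϱχ := ϱχ) (D := D) (σ := σ) P X ϱ C
  have hS := springL_nonneg (volterraField P S β₀) P X r₁ (ϱχ := ϱχ) (D := D) (σ := σ) ϱ C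
  have hN := nonAffL_nonneg (volterraField P S β₀) P X r₁ (ϱχ := ϱχ) (D := D) (σ := σ) ϱ C
  nlinarith [mul_le_mul_of_nonneg_right hc hM, mul_le_mul_of_nonneg_right hχ hT', mul_le_mul_of_nonneg_right hμ hS,
    mul_le_mul_of_nonneg_right hη hN]

/-- [GEO♮-ᶜ] is monotone in `ν₀`, in the exchange rate `η` and in both losses (each enlargement weakens the claim). -/
theorem GeoExchCls.mono {ν₀ ν₀' η η' c_T c_T' cχ cχ' : ℝ} (hν : ν₀ ≤ ν₀') (hη : η ≤ η') (hc : c_T ≤ c_T') (hχ : cχ ≤ cχ')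
    (h : GeoExchCls cls s lam ℓ μ₀ τ ϱ b₀ r_S ϱχ r₁ ν₀ η c_T cχ) : GeoExchCls cls s lam ℓ μ₀ τ ϱ b₀ r_S ϱχ r₁ ν₀' η' c_T' cχ' := by
  obtain ⟨c_H, hH, h⟩ := h
  refine ⟨c_H, hH, fun P C X β₀ k S m D σ h1 h2 hb h3 h4 h5 h6 h7 h8 h9 h10 h11 => ?_⟩
  have H := h P C X β₀ k S m D σ h1 h2 hb h3 h4 h5 h6 h7 h8 h9 h10 h11
  have hM := shellMassL_nonneg (ϱχ := ϱχ) (D := D) (σ := σ) P X ϱ C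
  have hT' := transMassL_nonneg (ϱχ := ϱχ) (D := D) (σ := σ) P X ϱ C
  have hS := springL_nonneg (volterraField P S β₀) P X r₁ (ϱχ := ϱχ) (D := D) (σ := σ) ϱ C
  have hN := nonAffL_nonneg (volterraField P S β₀) P X r₁ (ϱχ := ϱχ) (D := D) (σ := σ) ϱ C
  nlinarith [mul_le_mul_of_nonneg_right hc hM, mul_le_mul_of_nonneg_right hχ hT', mul_le_mul_of_nonneg_right hν hS,
    mul_le_mul_of_nonneg_right hη hN]

/-- ★ NODE 69 IS THE `η = 0` SLICE (bar side): [BAR♮-ᶜ](`μ₁, 0`) ↔ [BAR-ᶜ](`μ₁`). -/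
theorem barExchCls_zero_iff {μ₁ c_T cχ : ℝ} :
    BarExchCls cls s lam ℓ μ₀ τ ϱ b₀ r_S ϱχ r₁ μ₁ 0 c_T cχ ↔ BarCoerciveCls cls s lam ℓ μ₀ τ ϱ b₀ r_S ϱχ r₁ μ₁ c_T cχ := by
  simp only [BarExchCls, BarCoerciveCls, zero_mul, add_zero]

/-- ★ NODE 69 IS THE `η = 0` SLICE (prestress side): [GEO♮-ᶜ](`ν₀, 0`) ↔ [GEO-ᶜ](`ν₀`). -/
theorem geoExchCls_zero_iff {ν₀ c_T cχ : ℝ} :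
    GeoExchCls cls s lam ℓ μ₀ τ ϱ b₀ r_S ϱχ r₁ ν₀ 0 c_T cχ ↔ GeoStiffCls cls s lam ℓ μ₀ τ ϱ b₀ r_S ϱχ r₁ ν₀ c_T cχ := by
  simp only [GeoExchCls, GeoStiffCls, zero_mul, sub_zero]

/-- A proof of [BAR♮-ᶜ] with any `η ≥ 0` proves [BAR-ᶜ] (drop the non-negative non-affinity) … -/
theorem BarExchCls.barCoerciveCls {μ₁ η c_T cχ : ℝ} (hη : 0 ≤ η) (h : BarExchCls cls s lam ℓ μ₀ τ ϱ b₀ r_S ϱχ r₁ μ₁ η c_T cχ) :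
    BarCoerciveCls cls s lam ℓ μ₀ τ ϱ b₀ r_S ϱχ r₁ μ₁ c_T cχ :=
  barExchCls_zero_iff.1 (h.mono le_rfl hη le_rfl le_rfl)

/-- … and a proof of [GEO-ᶜ](`ν`) proves [GEO♮-ᶜ](`ν, η`) for every `η ≥ 0` (NODE 69's prestress piece is the `η = 0` corner of the family). -/
theorem GeoStiffCls.geoExchCls {ν η c_T cχ : ℝ} (hη : 0 ≤ η) (h : GeoStiffCls cls s lam ℓ μ₀ τ ϱ b₀ r_S ϱχ r₁ ν c_T cχ) :
    GeoExchCls cls s lam ℓ μ₀ τ ϱ b₀ r_S ϱχ r₁ ν η c_T cχ :=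
  (geoExchCls_zero_iff.2 h).mono le_rfl hη le_rfl le_rfl

end Pieces

end Summit.AtomisticToContinuum.Crystallization.Theorems.ChargedEnergyGapChartDial
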